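import Literature.NumberTheory.EllipticCurves.Sprung2012.SharpFlatSelmerDualRestrictionProofs
import Literature.NumberTheory.EllipticCurves.IwasawaDualFunctorialityProofs
import Mathlib.Algebra.Module.CharacterModule
import HarnessLib

/-!
# Route `ByReductionTypeAtTwo` (rung K4), crux `SupersingularRankZeroAtTwo` (item stmt-BirchSwinnertonDyer-19097), line
# `odd_blind_package`, slot 4 NF♭, sub-hand (hC-glob) of `HAND-TARGETS-NF-1.md`: **the kernel of `X ↠ X♭` is CYCLIC as soon as
# `Sel/Sel♭` embeds equivariantly into the discrete side of a dual pair whose compact side is cyclic** — Kitajima–Otsuki's exact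
# sequence (4.2) + Prop. 3.32 in the tree's axiomatic Pontryagin duality (`IwasawaDual.IsDualPair`), pure algebra
# (cell `bsd-2adic`, LEAD ss-1 GEN 23; `--supports 19097`, helper)

HONEST FRAMING: THEOREMS ONLY (no definition, no named fact, no `sorry`, no instance).  Nothing about any curve is computed; the
ARITHMETIC input of (hC-glob) — the Kummer pairing `Φ : Sel_{2^∞}(E/ℚ_∞) → (Ker Col♭)^∨` at the unique place of `ℚ_∞` over `2`, additive,
`(conj_γ − 1)`-equivariant, with kernel exactly `Sel♭` — is DISPLAYED, not constructed.  19097 OPEN; BSD is proved for no curve.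

* §1 `exists_forall_iff_mem_span_of_dualPair_map` — for dual pairs `(X, S, ψ)` and `(Y, Q, ψ_Q)` over `Λ = ℤ_p⟦T⟧` with `Y = Λ ∙ y₀` CYCLIC and
  an additive `Φ : S → Q` with `Φ ∘ ψ = ψ_Q ∘ Φ`: the annihilator `{x ∈ X | toDual x kills ker Φ}` is the cyclic submodule `Λ ∙ F(y₀)`, `F : Y → X`
  the transpose of `Φ` (`IsDualPair.exists_linearMap_comp`); the reverse inclusion extends a character of `Φ(S) ≅ S/ker Φ` to `Q` (`ℚ/ℤ` is
  injective: Mathlib `CharacterModule.dual_surjective_of_injective`).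
* §2 `mem_ker_iff_forall_toDual_sharpFlat` — for the canonical `π : X ↠ X♭` (pinning identity), `π x = 0 ⟺ toDual x` kills `Sel♭`.
* §3 `exists_ker_eq_span_singleton_of_pairing` — hence `ker π = Λ ∙ x₀` given a dual pair `(Y, Q)` with `Y` cyclic and an additive
  `(conj_γ − 1)`-equivariant `Φ : Sel_∞ → Q` whose kernel is `Sel♭` (Kitajima–Otsuki (4.2): `(H¹(k_∞,E[p^∞])/E♭_∞)^∨ ≅ Ker Col♭ → X ↠ X♭ → 0`).

References: [KitajimaOtsuki2018] (4.2), Prop. 3.32, Prop. 4.6 (arXiv:1607.03612 pp. 16–19); [GreenbergLNM1716] §1 p. 60; [Sprung2012] Def. 7.9, 7.11.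
-/

set_option autoImplicit false
-- the Theorems namespace of this sub repeats the summit name by design (D-0017 nested layout)
set_option linter.dupNamespace false

noncomputable section

open scoped Classical

namespace Summit.BirchSwinnertonDyer.BirchSwinnertonDyer.Theorems

namespace OddBlindNF

open Literature.NumberTheory.EllipticCurves Literature.NumberTheory.EllipticCurves.IwasawaDual

/-! ### §1 Dual-pair algebra: the annihilator of `ker Φ` is the image of the transpose of `Φ` -/

section DualPair

variable {p : ℕ} [Fact p.Prime]
variable {S : Type*} [AddCommGroup S] {ψ : AddMonoid.End S}
  {X : Type*} [AddCommGroup X] [Module (PowerSeries ℤ_[p]) X] {toDual : X →+ (S →+ AddCircle (1 : ℚ))}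
  {Q : Type*} [AddCommGroup Q] {ψQ : AddMonoid.End Q}
  {Y : Type*} [AddCommGroup Y] [Module (PowerSeries ℤ_[p]) Y] {toDualQ : Y →+ (Q →+ AddCircle (1 : ℚ))}

/-- **The annihilator of `ker Φ` is the range of the transpose of `Φ`.**  For dual pairs `(X, S, ψ)`, `(Y, Q, ψ_Q)` and an additive
`Φ : S → Q` with `Φ ∘ ψ = ψ_Q ∘ Φ`, let `F : Y → X` be the transpose (`toDual (F y) s = toDual_Q y (Φ s)`).  Then `x ∈ X` kills `ker Φ`
iff `x ∈ F(Y)`: (⇐) is immediate; (⇒) the character `toDual x` factors through `S/ker Φ ≅ Φ(S) ≤ Q` and extends to `Q` (`ℚ/ℤ` injective),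
i.e. equals `toDual_Q y ∘ Φ` for some `y`, whence `x = F y`. [cite: GreenbergLNM1716, §1 p. 60] [cite: KitajimaOtsuki2018, (4.2) (arXiv:1607.03612 p. 19)] -/
theorem forall_ker_imp_iff_mem_range_of_dualPair_map (hX : IsDualPair p ψ toDual) (hY : IsDualPair p ψQ toDualQ)
    (Φ : S →+ Q) {F : Y →ₗ[PowerSeries ℤ_[p]] X} (hF : ∀ (y : Y) (s : S), toDual (F y) s = toDualQ y (Φ s)) (x : X) :
    (∀ s : S, Φ s = 0 → toDual x s = 0) ↔ x ∈ LinearMap.range F := by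
  constructor
  · intro hx
    -- the character of `S` given by `x` factors through `Φ.range`
    have hker : Φ.ker ≤ (toDual x).ker := fun s hs ↦ by
      rw [AddMonoidHom.mem_ker] at hs ⊢
      exact hx s hs
    let χ₀ : S ⧸ Φ.ker →+ AddCircle (1 : ℚ) := QuotientAddGroup.lift Φ.ker (toDual x) hker
    let χ₁ : Φ.range →+ AddCircle (1 : ℚ) := χ₀.comp (QuotientAddGroup.quotientKerEquivRange Φ).symm.toAddMonoidHom
    have hχ₁ : ∀ s : S, χ₁ ⟨Φ s, ⟨s, rfl⟩⟩ = toDual x s := by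
      intro s
      have h1 : (QuotientAddGroup.quotientKerEquivRange Φ).symm ⟨Φ s, ⟨s, rfl⟩⟩ = (s : S ⧸ Φ.ker) := by
        apply (QuotientAddGroup.quotientKerEquivRange Φ).injective
        rw [AddEquiv.apply_symm_apply]
        rfl
      change χ₀ ((QuotientAddGroup.quotientKerEquivRange Φ).symm ⟨Φ s, ⟨s, rfl⟩⟩) = _
      rw [h1]
      rfl
    -- extend it along the injection `Φ.range ↪ Q`
    obtain ⟨χ₂, hχ₂⟩ := CharacterModule.dual_surjective_of_injective (R := ℤ) Φ.range.subtype.toIntLinearMap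
      (fun a b h ↦ Subtype.ext h) χ₁
    obtain ⟨y, hy⟩ := hY.bijective.2 χ₂
    refine ⟨y, hX.bijective.1 ?_⟩
    ext s
    rw [hF, hy, ← hχ₁ s, ← hχ₂]
    rfl
  · rintro ⟨y, rfl⟩ s hs
    rw [hF, hs, map_zero]

/-- **CYCLIC annihilator.**  In the situation of `forall_ker_imp_iff_mem_range_of_dualPair_map`, if the compact side `Y` of the target pair is
cyclic (`Y = Λ ∙ y₀`) then the annihilator of `ker Φ` in `X` is the cyclic submodule `Λ ∙ F(y₀)` — Kitajima–Otsuki's «the kernel of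
`X ↠ X^•` is the image of `(H¹(k_∞)/E^•)^∨ ≅ Λ`» in axiomatic form. [cite: KitajimaOtsuki2018, (4.2) and Prop. 3.32 (arXiv:1607.03612 pp. 16, 19)] -/
theorem exists_forall_iff_mem_span_of_dualPair_map (hX : IsDualPair p ψ toDual) (hY : IsDualPair p ψQ toDualQ)
    (y₀ : Y) (hy₀ : ∀ y : Y, ∃ f : PowerSeries ℤ_[p], f • y₀ = y)
    (Φ : S →+ Q) (hΦ : ∀ s, Φ (ψ s) = ψQ (Φ s)) :
    ∃ x₀ : X, ∀ x : X, (∀ s : S, Φ s = 0 → toDual x s = 0) ↔ x ∈ Submodule.span (PowerSeries ℤ_[p]) {x₀} := by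
  obtain ⟨F, hF⟩ := hY.exists_linearMap_comp hX Φ hΦ
  refine ⟨F y₀, fun x ↦ ?_⟩
  rw [forall_ker_imp_iff_mem_range_of_dualPair_map hX hY Φ hF x, LinearMap.mem_range, Submodule.mem_span_singleton]
  constructor
  · rintro ⟨y, rfl⟩
    obtain ⟨f, rfl⟩ := hy₀ y
    exact ⟨f, (F.map_smul f y₀).symm⟩
  · rintro ⟨f, rfl⟩
    exact ⟨f • y₀, F.map_smul f y₀⟩

end DualPair

/-! ### §2 The kernel of the canonical `X ↠ X♭` is the annihilator of `Sel♭` -/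

section Selmer

open NumberField IsDedekindDomain WeierstrassCurve Literature.NumberTheory.EllipticCurves.Sprung2017
  Literature.NumberTheory.EllipticCurves.Sprung2012 Literature.NumberTheory.GaloisRepresentations ZpExtension

universe u

variable {K : Type u} [Field K] [NumberField K] {W : WeierstrassCurve K} {p : ℕ} [Fact p.Prime] {κ : ZpExtension K p}
  {γ : Field.absoluteGaloisGroup K} {E : Type u} [Field E] [Algebra K E] {ι : AlgebraicClosure K →ₐ[K] AlgebraicClosure E}
  {ap : ℤ} {g : Field.absoluteGaloisGroup E} {c : ℕ → localPoints W E} {col : Chroma}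

/-- **`ker(X ↠ X^•)` = the annihilator of `Sel^•`.**  For `S : W.SelmerDualData κ γ`, `D : SharpFlatSelmerDualData W κ γ ι ap g c •` and ANY
additive `π : S.X → D.X` over the inclusion `Sel^• ≤ Sel` (pinning identity `D.toDual (π x) s = S.toDual x s`): `π x = 0` iff the character
`S.toDual x` kills `Sel^•` (`D.toDual` is injective). [cite: Sprung2012, Def. 7.11 (p. 1503)] [cite: GreenbergLNM1716, §1 p. 60] -/
theorem apply_eq_zero_iff_forall_toDual_sharpFlat (S : W.SelmerDualData κ γ) (D : SharpFlatSelmerDualData W κ γ ι ap g c col)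
{π : S.X →ₗ[IwasawaAlgebra p] D.X}
    (hpin : ∀ (x : S.X) (s : sharpFlatSelmerInfty W κ ι ap g c col),
      D.toDual (π x) s = S.toDual x (AddSubgroup.inclusion (sharpFlatSelmerInfty_le_selmerInfty W κ ι ap g c col) s))
    (x : S.X) :
    π x = 0 ↔ ∀ s : sharpFlatSelmerInfty W κ ι ap g c col,
      S.toDual x (AddSubgroup.inclusion (sharpFlatSelmerInfty_le_selmerInfty W κ ι ap g c col) s) = 0 := by
  constructor
  · intro hx s
    rw [← hpin, hx, map_zero, AddMonoidHom.zero_apply]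
  · intro h
    apply D.bijective.1
    ext s
    rw [hpin, h s, map_zero, AddMonoidHom.zero_apply]

/-- **(hC-glob) `ker(X ↠ X♭)` IS CYCLIC, from the Kummer-pairing embedding.**  Let `S : W.SelmerDualData κ γ` (classical dual, key `γ`),
`D` a `•`-dual datum in the same key, `π : S.X →ₗ D.X` over `Sel^• ≤ Sel`.  GIVEN a dual pair `(Y, Q, ψ_Q)` over `Λ = ℤ_p⟦T⟧` with `Y` CYCLIC
and an additive `Φ : Sel_{p^∞}(E/K_∞) → Q` with `Φ ∘ (conj_γ − 1) = ψ_Q ∘ Φ` whose kernel is exactly `Sel^•` — in the application `Y = Ker Col♭ ≅ Λ`,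
`Q` its discrete dual, `Φ` the Kummer pairing at the place over `p`, `ker Φ = Sel♭` by Def. 7.9/7.11 — the kernel of `π` is `Λ ∙ x₀`.
The displayed `Φ` is NOT constructed here. [cite: KitajimaOtsuki2018, (4.2), Prop. 3.32 (arXiv:1607.03612 pp. 16, 19)] [cite: Sprung2012, Def. 7.9, Def. 7.11] -/
theorem exists_ker_eq_span_singleton_of_pairing (S : W.SelmerDualData κ γ) (D : SharpFlatSelmerDualData W κ γ ι ap g c col)
    (π : S.X →ₗ[IwasawaAlgebra p] D.X)
    (hpin : ∀ (x : S.X) (s : sharpFlatSelmerInfty W κ ι ap g c col),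
      D.toDual (π x) s = S.toDual x (AddSubgroup.inclusion (sharpFlatSelmerInfty_le_selmerInfty W κ ι ap g c col) s))
    {Q : Type*} [AddCommGroup Q] {ψQ : AddMonoid.End Q}
    {Y : Type*} [AddCommGroup Y] [Module (IwasawaAlgebra p) Y] {toDualQ : Y →+ (Q →+ AddCircle (1 : ℚ))}
    (hY : IsDualPair p ψQ toDualQ) (y₀ : Y) (hy₀ : ∀ y : Y, ∃ f : IwasawaAlgebra p, f • y₀ = y)
    (Φ : W.selmerInfty κ →+ Q) (hΦ : ∀ s, Φ ((W.conjSelmerInfty κ γ - 1) s) = ψQ (Φ s))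
    (hkerΦ : ∀ s : W.selmerInfty κ, Φ s = 0 ↔ (s : W.subgroupH1 p κ.kerSubgroup) ∈ sharpFlatSelmerInfty W κ ι ap g c col) :
    ∃ x₀ : S.X, LinearMap.ker π = Submodule.span (IwasawaAlgebra p) {x₀} := by
  obtain ⟨x₀, hx₀⟩ := exists_forall_iff_mem_span_of_dualPair_map (S.isDualPair' W κ) hY y₀ hy₀ Φ hΦ
  refine ⟨x₀, ?_⟩
  ext x
  rw [LinearMap.mem_ker, ← hx₀ x,
    apply_eq_zero_iff_forall_toDual_sharpFlat S D hpin x]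
  constructor
  · intro h s hs
    have hmem : (s : W.subgroupH1 p κ.kerSubgroup) ∈ sharpFlatSelmerInfty W κ ι ap g c col := (hkerΦ s).mp hs
    have := h ⟨(s : W.subgroupH1 p κ.kerSubgroup), hmem⟩
    have e : AddSubgroup.inclusion (sharpFlatSelmerInfty_le_selmerInfty W κ ι ap g c col)
        ⟨(s : W.subgroupH1 p κ.kerSubgroup), hmem⟩ = s := Subtype.ext rfl
    rwa [e] at this
  · intro h s
    apply h
    rw [hkerΦ]
    exact s.2

end Selmer

end OddBlindNF

end Summit.BirchSwinnertonDyer.BirchSwinnertonDyer.Theorems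

end
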